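import Literature.NumberTheory.LFunctions.FordProgram1Run27A
import Literature.NumberTheory.LFunctions.FordProgram1Run27B
import Literature.NumberTheory.LFunctions.FordProgram1Run27C
import HarnessLib

/-!
# Ford's "Program 1": kernel run 27 (`940 ≤ k ≤ 956`)

Topic `Literature/NumberTheory/LFunctions`. Everything here is PROVED (standard axioms):
`FordP1.checkT k = true` for `940 ≤ k ≤ 956`, i.e. the certified re-run of PROGRAM 1 of
K. Ford, Proc. LMS 85 (2002) (the second part of Theorem 3) for these `k` — see `FordProgram1.lean`
for the checker, its soundness `FordP1.row_of_checkK`, and the meaning of the constants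
(`ρ = FordP1.rhoOf k / 10⁵`, `θ = FordP1.thetaOf k / 10⁴`, `ω = FordP1.omOf k / 10⁴`).

The kernel evaluations themselves now live in `FordProgram1Run27A.lean` (`940 ≤ k ≤ 945`),
`FordProgram1Run27B.lean` (`946 ≤ k ≤ 951`) and `FordProgram1Run27C.lean` (`952 ≤ k ≤ 956`), one
`decide +kernel` per `k` (a single 17-value kernel run exceeded the build's resource limits); this
file keeps the original range statement `FordP1.run27`, now assembled from those three runs without
any further kernel evaluation. The assembly of all runs is `FordTheorem3SmallK.lean`.

## References

* K. Ford, Proc. London Math. Soc. (3) 85 (2002), 565–633; arXiv:1910.08209: Theorem 3, (1.7),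
  Lemmas 3.4–3.5, Appendix "PROGRAM 1". [Ford2002]
-/

namespace Literature.NumberTheory.LFunctions
namespace FordP1

/-- **Kernel run 27**: `checkT k` for `940 ≤ k ≤ 956` (assembled from `run27A`, `run27B`,
`run27C`). [cite: Ford2002, Theorem 3 (second part) and PROGRAM 1] -/
theorem run27 : ((List.range' 940 17).all checkT) = true := by
  rw [List.all_eq_true]
  intro k hk
  obtain ⟨h1, h2⟩ := List.mem_range'_1.mp hk
  rcases lt_or_ge k 946 with h | h
  · exact run27A k (by omega) (by omega)
  rcases lt_or_ge k 952 with h' | h'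
  · exact run27B k (by omega) (by omega)
  · exact run27C k (by omega) (by omega)

end FordP1
end Literature.NumberTheory.LFunctions
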